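import Summits.ABC.ABC.Theses.RibetTakahashiSplit
import Summits.ABC.ABC.Theorems.RibetTakahashiSplitManyPrimeValuationProductFreyClassSuffices
import Summits.ABC.ABC.Theorems.RibetTakahashiSplitManyPrimeValuationProductStubFermatInputKnown
import Summits.ABC.ABC.Theorems.DefiniteXiXiStrongBoundAllTamExp
import Summits.ABC.ABC.Theorems.AbcValuationProduct
import Literature.NumberTheory.DiophantineGeometry.AbcValuationProduct

/-!
# `AbcValuationProduct` is Pasten's Conjecture 1.14 on the Frey–Hellegouarch class

The milestone `AbcValuationProduct` of route ABC/RibetTakahashiSplit (stmt-ABC-1567: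
`∏_{p ∣ abc} v_p(abc) ≤ K_ε rad(abc)^ε` for abc triples; Pasten's Theorem 1.10 of arXiv:1705.09251
with `8/3 + ε` replaced by `ε`, OPEN; formerly the route decl
`Summit.ABC.ABC.Theses.RibetTakahashiSplit.AbcValuationProduct`, dropped from the route's item list
2026-08-16 and re-homed verbatim as `Summit.ABC.ABC.Theorems.AbcValuationProduct` in
`Theorems/AbcValuationProduct.lean`, which this file now imports) is EQUIVALENT to
the valuation-product bound `T(E) = ∏_{p ∥ N} ord_p(Δ_min(E)) ≤ C_ε N_E^ε` on the route's own
Frey–Hellegouarch class — the hypothesis class of the crux `ManyPrimeValuationProductFrey`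
(stmt-ABC-15149: `E/ℚ` semistable away from `2` and `ℚ`-isomorphic to a twisted Frey curve
`freyCurve (d a) (d b)`, `a, b` coprime, `ab(a+b) ≠ 0`, `d ∣ 2`) with the regime hypothesis
"`≥ 4` odd multiplicative primes" dropped (`abcValuationProduct_iff_freyClass`).

Consequences recorded for the planner:
* `manyPrimeValuationProductFrey_of_abcValuationProduct`: the milestone IMPLIES the crux r2F
  (stmt-ABC-15149) — so stmt-ABC-1567 can close no earlier than stmt-ABC-15149;
* `fewPrimeValuationProductFrey_of_abcValuationProduct`: it implies the few-prime crux r4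
  (`FewPrimeValuationProduct`, stmt-ABC-1563) restricted to the same class;
* `abcValuationProduct_iff_manyPrimeFrey_and_fewPrimeFrey`: AbcValuationProduct ⟺ r2F ∧ r4F —
  re-cutting r4 to the Frey class (as r2 was re-cut to r2F in rev 6 of the route) loses nothing
  for this milestone, and after the re-cut the milestone is exactly the conjunction of the two
  cruxes (the converse of glue B `abcValuationProduct_of_manyPrimeFreyClass`, p88416).

Proof of the new direction (milestone ⟹ class bound), for `C' • W = freyCurve (d a) (d b)`,
`n = |ab(a+b)|`: `N` and `Δ_min` are transported along `C'`
(`ManyPrimeValuationProduct.conductorNorm_eq_of_smul_eq`, `…minimalDiscriminantNorm_eq_of_smul_eq`);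
at every prime `q`, `v_q(Δ_min) ≤ 4 + 2 v_q(|d|³ n) ≤ 10 + 2 v_q(n) ≤ 12 max(1, v_q(n))`
(`factorization_minimalDiscriminantNorm_freyCurve_le_add`: the minimal discriminant divides the
discriminant `16 d⁶ n²` of the integral model); hence `T ≤ 12^{ω(N)} ∏_{p ∣ n} v_p(n)`;
`12^{ω(N)} ≤ (2^{ω(N)})⁴ ≤ C₁⁴ N^{ε/2}` (`exists_two_pow_card_primeFactors_le` at `ε/8`); the signs
of `a, b, a + b` rearrange into an abc triple with product `n` (`exists_isABCTriple_of_isCoprime`),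
so the milestone at `ε/2` gives `∏_{p ∣ n} v_p(n) ≤ K rad(n)^{ε/2}`, and `rad(n) ≤ 2N` because
every odd prime of `n` is a multiplicative prime of the twisted Frey curve
(`ManyPrimeValuationProduct.factorization_conductorNorm_freyCurve_twist`). The old direction is
glue B without the case split (`FreyClassSuffices.exists_freyCurve_model`). No new definitions.

References: H. Pasten, *Shimura curves and the abc conjecture*, J. Number Theory 254 (2024)
= arXiv:1705.09251, Conj. 1.14, Thm 1.10; E. Bombieri, W. Gubler, *Heights in Diophantine
Geometry* (2006), Ex. 12.5.10.
-/

-- `Summit.<Summit>.<Problem>` is the mandated summit-side namespace (CONVENTIONS §2); for the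
-- single-conjunct summit `ABC` the two coincide, so the duplicate `ABC.ABC` is deliberate.
set_option linter.dupNamespace false

noncomputable section

namespace Summit.ABC.ABC.Theorems

open WeierstrassCurve UniqueFactorizationMonoid
open Literature.NumberTheory.EllipticCurves Literature.NumberTheory.DiophantineGeometry
open Summit.ABC.ABC.Theses.RibetTakahashiSplit

/-! ## The milestone implies the valuation-product bound on the whole Frey–Hellegouarch class -/

/-- **`AbcValuationProduct` ⟹ Conj. 1.14 on the Frey–Hellegouarch class.** If
`∏_{p ∣ abc} v_p(abc) ≤ K_ε rad(abc)^ε` for all abc triples, then for every elliptic `W/ℚ` that is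
`ℚ`-isomorphic to a twisted Frey curve `freyCurve (d a) (d b)` (`a, b` coprime, `ab(a+b) ≠ 0`,
`d ∣ 2`): `T(W) = ∏_{p ∣ N, p² ∤ N} ord_p(Δ_min) ≤ C_ε N^ε` — with no hypothesis on the number of
multiplicative primes and none on semistability. Chain (`n = |ab(a+b)|`):
`ord_q(Δ_min) ≤ 4 + 2 v_q(|d|³ n) ≤ 12 max(1, v_q(n))` at every prime, so
`T ≤ 12^{ω(N)} ∏_{p ∣ n} v_p(n)`; `12^{ω(N)} ≤ (2^{ω(N)})⁴ ≤ C₁⁴ N^{ε/2}`; the milestone on the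
rearranged triple gives `∏_{p ∣ n} v_p(n) ≤ K rad(n)^{ε/2} ≤ max(K,0) (2N)^{ε/2}`. [folklore] -/
theorem AbcValuationProduct.freyClass_valuationProduct_le (hAVP : AbcValuationProduct) :
    ∀ ε : ℝ, 0 < ε → ∃ C : ℝ, ∀ (W : WeierstrassCurve ℚ) [W.IsElliptic],
      (∃ (a b d : ℤ) (C' : VariableChange ℚ), IsCoprime a b ∧ a * b * (a + b) ≠ 0 ∧ d ∣ 2 ∧
        C' • W = freyCurve (d * a) (d * b)) →
      ((∏ p ∈ (W.conductorNorm ℤ).primeFactors with ¬ p ^ 2 ∣ W.conductorNorm ℤ,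
        (W.minimalDiscriminantNorm ℤ).factorization p : ℕ) : ℝ) ≤
          C * (W.conductorNorm ℤ : ℝ) ^ ε := by
  intro ε hε
  -- the milestone at `ε/2`; the squarefree-kernel bound `2^ω ≤ C₁ rad^δ` at `δ = ε/8`
  obtain ⟨K, hK⟩ := hAVP (ε / 2) (by positivity)
  obtain ⟨C₁, hC₁, hω⟩ := exists_two_pow_card_primeFactors_le (ε / 8) (by positivity)
  refine ⟨C₁ ^ 4 * max K 0 * (2 : ℝ) ^ (ε / 2), fun W _ hfrey => ?_⟩
  obtain ⟨a, b, d, C', hab, h0, hd, hW⟩ := hfrey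
  -- transport `N` and `Δ_min` to the twisted Frey curve
  have hd0 : d ≠ 0 := by rintro rfl; simp at hd
  have h0' : d * a * (d * b) * (d * a + d * b) ≠ 0 := by
    rw [show d * a * (d * b) * (d * a + d * b) = (d * d * d) * (a * b * (a + b)) by ring]
    exact mul_ne_zero (by simp [hd0]) h0
  rw [ManyPrimeValuationProduct.conductorNorm_eq_of_smul_eq hW,
    ManyPrimeValuationProduct.minimalDiscriminantNorm_eq_of_smul_eq hW]
  haveI hE := isElliptic_freyCurve h0'
  set N : ℕ := (freyCurve (d * a) (d * b)).conductorNorm ℤ with hNdef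
  set D : ℕ := (freyCurve (d * a) (d * b)).minimalDiscriminantNorm ℤ with hDdef
  set n : ℕ := (a * b * (a + b)).natAbs with hn
  have hn0 : n ≠ 0 := Int.natAbs_ne_zero.mpr h0
  have hNpos : 0 < N := conductorNorm_pos_holds _
  have hNreal : (0 : ℝ) < (N : ℝ) := by exact_mod_cast hNpos
  set S : Finset ℕ := N.primeFactors.filter (fun p => ¬ p ^ 2 ∣ N) with hS
  have hSN : S ⊆ N.primeFactors := Finset.filter_subset _ _
  -- (1) per-prime bound `ord_q(Δ_min) ≤ 12 max(1, v_q(n))`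
  have hq : ∀ q ∈ S, D.factorization q ≤ 12 * max 1 (n.factorization q) := by
    intro q hqS
    have hqP : q.Prime := Nat.prime_of_mem_primeFactors (hSN hqS)
    have h1 := factorization_minimalDiscriminantNorm_freyCurve_le_add h0' hqP
    have h2 : (d * a * (d * b) * (d * a + d * b)).natAbs.factorization q ≤
        3 + n.factorization q := by
      rw [show d * a * (d * b) * (d * a + d * b) = (d * d * d) * (a * b * (a + b)) by ring,
        Int.natAbs_mul, Nat.factorization_mul (by simp [hd0]) hn0, Finsupp.add_apply]
      refine Nat.add_le_add_right ?_ _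
      have h8 : (d * d * d).natAbs ∣ 2 ^ 3 := by
        have h := Int.natAbs_dvd_natAbs.mpr (mul_dvd_mul (mul_dvd_mul hd hd) hd)
        simpa using h
      calc (d * d * d).natAbs.factorization q ≤ (2 ^ 3).factorization q :=
            (Nat.factorization_le_iff_dvd (by simp [hd0]) (by norm_num)).mpr h8 q
        _ ≤ 3 := by
            rw [Nat.factorization_pow, Finsupp.smul_apply, smul_eq_mul,
              Nat.prime_two.factorization, Finsupp.single_apply]
            split_ifs <;> omega
    have h3 : 1 ≤ max 1 (n.factorization q) := le_max_left _ _
    have h4 : n.factorization q ≤ max 1 (n.factorization q) := le_max_right _ _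
    rw [← hDdef] at h1
    omega
  -- (2) the product bound in `ℕ`: `T ≤ 12^ω(N) · ∏_{p ∣ n} v_p(n)`
  have hT : ∏ q ∈ S, D.factorization q ≤
      12 ^ N.primeFactors.card * ∏ p ∈ n.primeFactors, n.factorization p := by
    have h1 : ∏ q ∈ S, D.factorization q ≤ ∏ q ∈ S, 12 * max 1 (n.factorization q) :=
      Finset.prod_le_prod (fun _ _ => Nat.zero_le _) hq
    have h2 : ∏ q ∈ S, max 1 (n.factorization q) ≤
        ∏ q ∈ S ∪ n.primeFactors, max 1 (n.factorization q) :=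
      Finset.prod_le_prod_of_subset_of_one_le' Finset.subset_union_left
        fun _ _ _ => le_max_left _ _
    have h3 : ∏ q ∈ n.primeFactors, max 1 (n.factorization q) =
        ∏ q ∈ S ∪ n.primeFactors, max 1 (n.factorization q) := by
      refine Finset.prod_subset Finset.subset_union_right fun q _ hqn => ?_
      have h : n.factorization q = 0 :=
        Finsupp.notMem_support_iff.mp (by rwa [Nat.support_factorization])
      rw [h, max_eq_left (Nat.zero_le 1)]
    have h4 : ∏ q ∈ n.primeFactors, max 1 (n.factorization q) =
        ∏ q ∈ n.primeFactors, n.factorization q :=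
      Finset.prod_congr rfl fun q hqn => max_eq_right
        (Nat.Prime.factorization_pos_of_dvd (Nat.prime_of_mem_primeFactors hqn) hn0
          (Nat.dvd_of_mem_primeFactors hqn))
    have h5 : 12 ^ S.card ≤ 12 ^ N.primeFactors.card :=
      Nat.pow_le_pow_right (by norm_num) (Finset.card_le_card hSN)
    calc ∏ q ∈ S, D.factorization q
        ≤ ∏ q ∈ S, 12 * max 1 (n.factorization q) := h1
      _ = 12 ^ S.card * ∏ q ∈ S, max 1 (n.factorization q) := by
          rw [Finset.prod_mul_distrib, Finset.prod_const]
      _ ≤ 12 ^ N.primeFactors.card * ∏ q ∈ n.primeFactors, n.factorization q := by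
          rw [← h4, h3]; exact Nat.mul_le_mul h5 h2
  -- (3) `12^ω(N) ≤ (2^ω(N))⁴ ≤ (C₁ rad(N)^{ε/8})⁴ ≤ C₁⁴ N^{ε/2}`
  have hradN : (∏ p ∈ N.primeFactors, (p : ℝ)) ≤ (N : ℝ) := by
    have h := Nat.le_of_dvd hNpos (Nat.prod_primeFactors_dvd N)
    rw [← Nat.cast_prod]
    exact_mod_cast h
  have h2ω : (2 : ℝ) ^ N.primeFactors.card ≤ C₁ * (N : ℝ) ^ (ε / 8) :=
    (hω N).trans (mul_le_mul_of_nonneg_left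
      (Real.rpow_le_rpow (by positivity) hradN (by positivity)) hC₁.le)
  have h12ω : (12 : ℝ) ^ N.primeFactors.card ≤ C₁ ^ 4 * (N : ℝ) ^ (ε / 2) := by
    calc (12 : ℝ) ^ N.primeFactors.card ≤ (2 ^ 4) ^ N.primeFactors.card :=
          pow_le_pow_left₀ (by norm_num) (by norm_num) _
      _ = ((2 : ℝ) ^ N.primeFactors.card) ^ 4 := by rw [← pow_mul, mul_comm, pow_mul]
      _ ≤ (C₁ * (N : ℝ) ^ (ε / 8)) ^ 4 := pow_le_pow_left₀ (by positivity) h2ω 4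
      _ = C₁ ^ 4 * ((N : ℝ) ^ (ε / 8)) ^ (4 : ℕ) := mul_pow _ _ _
      _ = C₁ ^ 4 * (N : ℝ) ^ (ε / 2) := by
          congr 1
          rw [← Real.rpow_natCast ((N : ℝ) ^ (ε / 8)) 4, ← Real.rpow_mul hNreal.le]
          congr 1
          push_cast
          ring
  -- (4) `rad(n) ≤ 2N`: every odd prime of `n` is a multiplicative prime of the twisted curve
  have hsub : n.primeFactors ⊆ insert 2 N.primeFactors := by
    intro p hp
    rw [Finset.mem_insert]
    by_cases hp2 : p = 2
    · exact Or.inl hp2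
    refine Or.inr ?_
    have hpP : p.Prime := Nat.prime_of_mem_primeFactors hp
    have hpn : (p : ℤ) ∣ a * b * (a + b) := Int.natCast_dvd.mpr (Nat.dvd_of_mem_primeFactors hp)
    have hf := ManyPrimeValuationProduct.factorization_conductorNorm_freyCurve_twist hab h0 hd hpP hp2
    rw [if_pos hpn, ← hNdef] at hf
    rw [← Nat.support_factorization, Finsupp.mem_support_iff, hf]
    exact one_ne_zero
  have hradn : radical n ≤ 2 * N := by
    rw [Nat.radical_eq_prod_primeFactors]
    calc ∏ p ∈ n.primeFactors, p ≤ ∏ p ∈ insert 2 N.primeFactors, p :=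
          Finset.prod_le_prod_of_subset_of_one_le' hsub fun p hp _ => by
            rcases Finset.mem_insert.mp hp with rfl | hp
            · norm_num
            · exact (Nat.prime_of_mem_primeFactors hp).one_le
      _ ≤ 2 * ∏ p ∈ N.primeFactors, p := by
          by_cases h2N : 2 ∈ N.primeFactors
          · rw [Finset.insert_eq_of_mem h2N]
            exact Nat.le_mul_of_pos_left _ two_pos
          · rw [Finset.prod_insert h2N]
      _ ≤ 2 * N := Nat.mul_le_mul_left 2 (Nat.le_of_dvd hNpos (Nat.prod_primeFactors_dvd N))
  -- (5) the milestone on the rearranged triple: `∏_{p ∣ n} v_p(n) ≤ max(K,0) (2N)^{ε/2}`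
  obtain ⟨x, y, z, hxyz, hprod⟩ := exists_isABCTriple_of_isCoprime hab h0
  have hK' := hK x y z hxyz
  rw [rad_def, hprod, ← hn] at hK'
  have hradnR : ((radical n : ℕ) : ℝ) ≤ 2 * (N : ℝ) := by exact_mod_cast hradn
  have hP : ((∏ p ∈ n.primeFactors, n.factorization p : ℕ) : ℝ) ≤
      max K 0 * ((2 : ℝ) ^ (ε / 2) * (N : ℝ) ^ (ε / 2)) := by
    calc ((∏ p ∈ n.primeFactors, n.factorization p : ℕ) : ℝ)
        ≤ K * ((radical n : ℕ) : ℝ) ^ (ε / 2) := hK'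
      _ ≤ max K 0 * ((radical n : ℕ) : ℝ) ^ (ε / 2) :=
          mul_le_mul_of_nonneg_right (le_max_left _ _) (by positivity)
      _ ≤ max K 0 * (2 * (N : ℝ)) ^ (ε / 2) :=
          mul_le_mul_of_nonneg_left (Real.rpow_le_rpow (by positivity) hradnR (by positivity))
            (le_max_right _ _)
      _ = max K 0 * ((2 : ℝ) ^ (ε / 2) * (N : ℝ) ^ (ε / 2)) := by
          rw [Real.mul_rpow (by norm_num) hNreal.le]
  -- (6) assemble
  have hTreal : ((∏ q ∈ S, D.factorization q : ℕ) : ℝ) ≤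
      (12 : ℝ) ^ N.primeFactors.card * ((∏ p ∈ n.primeFactors, n.factorization p : ℕ) : ℝ) := by
    exact_mod_cast hT
  calc ((∏ q ∈ S, D.factorization q : ℕ) : ℝ)
      ≤ (12 : ℝ) ^ N.primeFactors.card * ((∏ p ∈ n.primeFactors, n.factorization p : ℕ) : ℝ) :=
        hTreal
    _ ≤ (C₁ ^ 4 * (N : ℝ) ^ (ε / 2)) * (max K 0 * ((2 : ℝ) ^ (ε / 2) * (N : ℝ) ^ (ε / 2))) :=
        mul_le_mul h12ω hP (by positivity) (by positivity)
    _ = C₁ ^ 4 * max K 0 * (2 : ℝ) ^ (ε / 2) * ((N : ℝ) ^ (ε / 2) * (N : ℝ) ^ (ε / 2)) := by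
        ring
    _ = C₁ ^ 4 * max K 0 * (2 : ℝ) ^ (ε / 2) * (N : ℝ) ^ ε := by
        rw [← Real.rpow_add hNreal, add_halves]

/-! ## The converse: glue B on the class, without the regime split -/

/-- **Conj. 1.14 on the Frey–Hellegouarch class ⟹ `AbcValuationProduct`** (glue B of the route
without its case split on the number of odd multiplicative primes): the curve attached to an abc
triple by `FreyClassSuffices.exists_freyCurve_model` is semistable away from `2`, lies in the
class, has `N ∣ 2¹⁰ rad(abc)` and `∏_{p ∣ abc} v_p(abc) ≤ 4 T`. [folklore] -/
theorem abcValuationProduct_of_freyClass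
    (hF : ∀ ε : ℝ, 0 < ε → ∃ C : ℝ, ∀ (W : WeierstrassCurve ℚ) [W.IsElliptic],
      (∀ p : ℕ, p.Prime → p ≠ 2 → ¬ p ^ 2 ∣ W.conductorNorm ℤ) →
      (∃ (a b d : ℤ) (C' : VariableChange ℚ), IsCoprime a b ∧ a * b * (a + b) ≠ 0 ∧ d ∣ 2 ∧
        C' • W = freyCurve (d * a) (d * b)) →
      ((∏ p ∈ (W.conductorNorm ℤ).primeFactors with ¬ p ^ 2 ∣ W.conductorNorm ℤ,
        (W.minimalDiscriminantNorm ℤ).factorization p : ℕ) : ℝ) ≤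
          C * (W.conductorNorm ℤ : ℝ) ^ ε) :
    AbcValuationProduct := by
  intro ε hε
  obtain ⟨C₂, hC₂⟩ := hF ε hε
  set C : ℝ := max C₂ 0 with hCdef
  have hC0 : 0 ≤ C := le_max_right _ _
  refine ⟨4 * C * ((2 : ℝ) ^ 10) ^ ε, fun a b c h => ?_⟩
  obtain ⟨W, hE, hss, hfrey, hN, -, hprod⟩ := FreyClassSuffices.exists_freyCurve_model h
  haveI := hE
  have hT : (multiplicativeValuationProduct W : ℝ) ≤ C * (W.conductorNorm ℤ : ℝ) ^ ε :=
    (hC₂ W hss hfrey).trans (mul_le_mul_of_nonneg_right (le_max_left _ _) (by positivity))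
  set N : ℝ := ((W.conductorNorm ℤ : ℕ) : ℝ) with hNdef
  set R : ℝ := ((rad a b c : ℕ) : ℝ) with hRdef
  have hR0 : 0 < R := by
    rw [hRdef, rad_def]; exact_mod_cast Nat.radical_pos _
  have hNR : N ≤ 2 ^ 10 * R := by
    have := Nat.le_of_dvd (mul_pos (by positivity) (by rw [rad_def]; exact Nat.radical_pos _)) hN
    rw [hNdef, hRdef]; exact_mod_cast this
  calc ((∏ p ∈ (a * b * c).primeFactors, (a * b * c).factorization p : ℕ) : ℝ)
      ≤ ((4 * multiplicativeValuationProduct W : ℕ) : ℝ) := by exact_mod_cast hprod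
    _ = 4 * (multiplicativeValuationProduct W : ℝ) := by push_cast; ring
    _ ≤ 4 * (C * N ^ ε) := by gcongr
    _ ≤ 4 * (C * (2 ^ 10 * R) ^ ε) := by gcongr
    _ = 4 * C * ((2 : ℝ) ^ 10) ^ ε * R ^ ε := by
        rw [Real.mul_rpow (by positivity) hR0.le]; ring

/-! ## The equivalences and the two cruxes -/

/-- **`AbcValuationProduct` ⟺ Conj. 1.14 on the Frey–Hellegouarch class** (the hypothesis class of
the crux `ManyPrimeValuationProductFrey`, stmt-ABC-15149, with the regime hypothesis "`≥ 4` odd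
multiplicative primes" dropped): Pasten's `d(abc) = rad(abc)^{o(1)}` is exactly
`T(E) ≤ C_ε N_E^ε` for the curves `E/ℚ` semistable away from `2` and `ℚ`-isomorphic to a twisted
Frey curve. [folklore] -/
theorem abcValuationProduct_iff_freyClass :
    AbcValuationProduct ↔
      ∀ ε : ℝ, 0 < ε → ∃ C : ℝ, ∀ (W : WeierstrassCurve ℚ) [W.IsElliptic],
        (∀ p : ℕ, p.Prime → p ≠ 2 → ¬ p ^ 2 ∣ W.conductorNorm ℤ) →
        (∃ (a b d : ℤ) (C' : VariableChange ℚ), IsCoprime a b ∧ a * b * (a + b) ≠ 0 ∧ d ∣ 2 ∧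
          C' • W = freyCurve (d * a) (d * b)) →
        ((∏ p ∈ (W.conductorNorm ℤ).primeFactors with ¬ p ^ 2 ∣ W.conductorNorm ℤ,
          (W.minimalDiscriminantNorm ℤ).factorization p : ℕ) : ℝ) ≤
            C * (W.conductorNorm ℤ : ℝ) ^ ε := by
  refine ⟨fun h ε hε => ?_, abcValuationProduct_of_freyClass⟩
  obtain ⟨C, hC⟩ := AbcValuationProduct.freyClass_valuationProduct_le h ε hε
  exact ⟨C, fun W _ _ hfrey => hC W hfrey⟩

/-- **The milestone implies the crux r2F.** `AbcValuationProduct` (stmt-ABC-1567) implies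
`ManyPrimeValuationProductFrey` (stmt-ABC-15149): the milestone is at least as strong as the
many-prime crux on the Frey class, so it can close no earlier. [folklore] -/
theorem manyPrimeValuationProductFrey_of_abcValuationProduct (h : AbcValuationProduct) :
    ManyPrimeValuationProductFrey := by
  intro ε hε
  obtain ⟨C, hC⟩ := AbcValuationProduct.freyClass_valuationProduct_le h ε hε
  exact ⟨C, fun W _ _ hfrey _ => hC W hfrey⟩

/-- **The milestone implies the few-prime crux on the Frey class.** `AbcValuationProduct` implies
`FewPrimeValuationProduct` (stmt-ABC-1563) restricted to curves `ℚ`-isomorphic to a twisted Frey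
curve (`≤ 3` odd multiplicative primes: the Pillai/Catalan regime `p^x ± q^y = 2^k r^z`).
[folklore] -/
theorem fewPrimeValuationProductFrey_of_abcValuationProduct (h : AbcValuationProduct) :
    ∀ ε : ℝ, 0 < ε → ∃ C : ℝ, ∀ (W : WeierstrassCurve ℚ) [W.IsElliptic],
      (∀ p : ℕ, p.Prime → p ≠ 2 → ¬ p ^ 2 ∣ W.conductorNorm ℤ) →
      (∃ (a b d : ℤ) (C' : VariableChange ℚ), IsCoprime a b ∧ a * b * (a + b) ≠ 0 ∧ d ∣ 2 ∧
        C' • W = freyCurve (d * a) (d * b)) →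
      ((W.conductorNorm ℤ).primeFactors.filter
        (fun p => p ≠ 2 ∧ ¬ p ^ 2 ∣ W.conductorNorm ℤ)).card ≤ 3 →
      ((∏ p ∈ (W.conductorNorm ℤ).primeFactors with ¬ p ^ 2 ∣ W.conductorNorm ℤ,
        (W.minimalDiscriminantNorm ℤ).factorization p : ℕ) : ℝ) ≤
          C * (W.conductorNorm ℤ : ℝ) ^ ε := by
  intro ε hε
  obtain ⟨C, hC⟩ := AbcValuationProduct.freyClass_valuationProduct_le h ε hε
  exact ⟨C, fun W _ _ hfrey _ => hC W hfrey⟩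

/-- **`AbcValuationProduct` ⟺ r2F ∧ r4F.** The milestone is equivalent to the conjunction of the
many-prime crux on the Frey class (`ManyPrimeValuationProductFrey`, stmt-ABC-15149) and the
few-prime crux `FewPrimeValuationProduct` (stmt-ABC-1563) restricted to the Frey class: re-cutting
r4 to the Frey class, as r2 was re-cut in rev 6 of the route, loses nothing for this milestone,
and then the milestone is exactly the conjunction of the two cruxes. [folklore] -/
theorem abcValuationProduct_iff_manyPrimeFrey_and_fewPrimeFrey :
    AbcValuationProduct ↔
      (ManyPrimeValuationProductFrey ∧
        ∀ ε : ℝ, 0 < ε → ∃ C : ℝ, ∀ (W : WeierstrassCurve ℚ) [W.IsElliptic],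
          (∀ p : ℕ, p.Prime → p ≠ 2 → ¬ p ^ 2 ∣ W.conductorNorm ℤ) →
          (∃ (a b d : ℤ) (C' : VariableChange ℚ), IsCoprime a b ∧ a * b * (a + b) ≠ 0 ∧ d ∣ 2 ∧
            C' • W = freyCurve (d * a) (d * b)) →
          ((W.conductorNorm ℤ).primeFactors.filter
            (fun p => p ≠ 2 ∧ ¬ p ^ 2 ∣ W.conductorNorm ℤ)).card ≤ 3 →
          ((∏ p ∈ (W.conductorNorm ℤ).primeFactors with ¬ p ^ 2 ∣ W.conductorNorm ℤ,
            (W.minimalDiscriminantNorm ℤ).factorization p : ℕ) : ℝ) ≤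
              C * (W.conductorNorm ℤ : ℝ) ^ ε) := by
  refine ⟨fun h => ⟨manyPrimeValuationProductFrey_of_abcValuationProduct h,
    fewPrimeValuationProductFrey_of_abcValuationProduct h⟩, fun ⟨h₂, h₄⟩ => ?_⟩
  refine abcValuationProduct_of_freyClass fun ε hε => ?_
  obtain ⟨C₂, hC₂⟩ := h₂ ε hε
  obtain ⟨C₄, hC₄⟩ := h₄ ε hε
  refine ⟨max C₂ C₄, fun W _ hss hfrey => ?_⟩
  have hNε : 0 ≤ (W.conductorNorm ℤ : ℝ) ^ ε := by positivity
  rcases le_or_gt 4 ((W.conductorNorm ℤ).primeFactors.filter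
      (fun p => p ≠ 2 ∧ ¬ p ^ 2 ∣ W.conductorNorm ℤ)).card with h4 | h3
  · exact (hC₂ W hss hfrey h4).trans (mul_le_mul_of_nonneg_right (le_max_left _ _) hNε)
  · exact (hC₄ W hss hfrey (by omega)).trans (mul_le_mul_of_nonneg_right (le_max_right _ _) hNε)

end Summit.ABC.ABC.Theorems

end
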